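import Literature.Algebra.Homology.DiscreteRepExtInternalHomGalois
import Literature.NumberTheory.GaloisRepresentations.ContinuousCohomologyConnecting
import Literature.Algebra.Homology.DiscreteRepGaloisCorollaries
import Mathlib.Algebra.Category.ModuleCat.Injective
import HarnessLib

/-!
# The `Hom(·, A)`-dual of a presentation `0 → N₁ → P → N → 0` of discrete Galois modules and its
# connecting map `δ₀ : Hom_Γ(N₁, A) → H¹(K, Hom(N, A))` (native continuous cochains)

Topic `NumberTheory/GaloisRepresentations`; namespace `Literature.NumberTheory.GaloisRepresentations.HomDual`.
Definitions with bodies (`precomp`, the dual intertwining maps) and theorems; no named fact, no instance,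
no `sorry`.  Any field `K : Type`; all cohomology is the tree's NATIVE `galoisCohomology`
(continuous cochains) with the native connecting map `IsSES.δ₀` of `ContinuousCohomologyConnecting`.

THE MATHEMATICS.  Let `0 → N₁ —i→ P —p→ N → 0` be a short exact sequence of discrete `Γ_K`-modules,
finitely generated over `ℤ`, and `A` a discrete `Γ_K`-module whose underlying group is an injective
`ℤ`-module (Baer; e.g. divisible: `K̄ˣ`, `K̄_vˣ`).  Then
`0 → Hom(N, A) —p^*→ Hom(P, A) —i^*→ Hom(N₁, A) → 0` is again a short exact sequence of discrete
`Γ_K`-modules (`isSES_dual`; exactness on the right is Baer's criterion), whence the connecting map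
**`δ₀ : Hom(N₁, A)^{Γ_K} = Hom_{Γ_K}(N₁, A) → H¹(K, Hom(N, A))`** (`dualδ₀`), with:
* `mem_invariants_iff` — the invariants of `Hom(X, A)` are the equivariant homomorphisms;
* `dualδ₀_precomp_eq_zero` — the restriction `q ∘ i` of an EQUIVARIANT `q : P → A` has `δ₀ = 0`;
* `dualδ₀_eq_dualδ₀_iff` — two equivariant `h, h' : N₁ → A` have the same `δ₀` iff they differ by such a
  restriction;
* **`dualδ₀_surjective`** — if `H¹(K, Hom(P, A)) = 0` then EVERY class of `H¹(K, Hom(N, A))` is `δ₀ h`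
  for an equivariant homomorphism `h : N₁ → A` (exactness at `H¹`).

USE (the "presentation road" to Milne ADT I Lemma 4.13 / Thm. 4.10, crux `stmt-BirchSwinnertonDyer-19295`,
cell `bsd-schneider-ideate`, door-c6 gen 16): with `P = ℤ[Gal(E₀/K)]ᵐ` (door-c4's free presentation of
`N = M^D`) and `A = K̄_vˣ`, `H¹(K_v, Hom(N, K̄_vˣ)) = H¹(K_v, M)` and the vanishing `H¹(K_v, Hom(P, K̄_vˣ)) = 0`
(sequel `HomPermutationModuleVanishing`) make `δ₀` ONTO: every local class `t_v ∈ H¹(K_v, M)` is the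
READOUT `δ₀(h_v)` of a `Γ_{K_v}`-equivariant homomorphism `h_v : N₁ → K̄_vˣ` — the local content of
Lemma 4.13 at the level of homomorphisms.
HONEST FRAMING: no case of Poitou–Tate or BSD is proved here.

## References
* J. S. Milne, *Arithmetic Duality Theorems* (2nd ed. 2006), I §0 (0.8), I Lemma 4.13 (proof). [MilneADT2006]
* J.-P. Serre, *Galois Cohomology* (1997), I §2.2 (the exact cohomology sequence). [SerreGaloisCohomology1997]
* C. A. Weibel, *An introduction to homological algebra* (1994), §2.3 (Baer's criterion), §2.7. [Weibel1994]
-/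

noncomputable section

namespace Literature.NumberTheory.GaloisRepresentations

namespace HomDual

open Literature.Algebra.Homology Literature.Algebra.Homology.DiscreteRep ContRepresentation Field

variable {K : Type} [Field K]
variable {X Y Z W : Type}
  [AddCommGroup X] [TopologicalSpace X] [DiscreteTopology X] [Module.Finite ℤ X]
  [AddCommGroup Y] [TopologicalSpace Y] [DiscreteTopology Y] [Module.Finite ℤ Y]
  [AddCommGroup Z] [TopologicalSpace Z] [DiscreteTopology Z] [Module.Finite ℤ Z]
  [AddCommGroup W] [TopologicalSpace W] [DiscreteTopology W]
variable (ρX : DiscreteGaloisModule K X) (ρY : DiscreteGaloisModule K Y) (ρZ : DiscreteGaloisModule K Z)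
  (ρA : DiscreteGaloisModule K W)

/-! ## §1 Precomposition `Hom(Y, A) → Hom(X, A)` along an equivariant `u : X → Y` -/

/-- The underlying additive map `F ↦ F ∘ u` on the `Hom`-carriers. [cite: MilneADT2006, I §0 (0.8)] -/
def precompAddHom (u : X →ₗ[ℤ] Y) : DiscreteRep.HomCarrier Y W →+ DiscreteRep.HomCarrier X W where
  toFun F := (show Y →ₗ[ℤ] W from F) ∘ₗ u
  map_zero' := rfl
  map_add' _ _ := rfl

omit [TopologicalSpace X] [DiscreteTopology X] [Module.Finite ℤ X] [TopologicalSpace Y] [DiscreteTopology Y]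
  [Module.Finite ℤ Y] [TopologicalSpace W] [DiscreteTopology W] in
/-- Unfolding. [cite: MilneADT2006, I §0 (0.8)] -/
@[simp] theorem precompAddHom_apply_apply (u : X →ₗ[ℤ] Y) (F : DiscreteRep.HomCarrier Y W) (x : X) :
    (show X →ₗ[ℤ] W from precompAddHom (W := W) u F) x = (show Y →ₗ[ℤ] W from F) (u x) := rfl

/-- **`u^* : Hom(Y, A) → Hom(X, A)`, `F ↦ F ∘ u`, as a continuous equivariant map of discrete Galois
modules** for an equivariant `u : X → Y`. [cite: MilneADT2006, I §0 (0.8)] -/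
def precomp (u : ρX.toContRepresentation →ⁱL ρY.toContRepresentation) :
    (homGaloisModule ρY ρA).toContRepresentation →ⁱL (homGaloisModule ρX ρA).toContRepresentation where
  toLinearMap := (precompAddHom (W := W) u.toContinuousLinearMap.toLinearMap).toIntLinearMap
  cont := continuous_of_discreteTopology
  isIntertwining' σ := by
    refine ContinuousLinearMap.ext fun F => ?_
    refine LinearMap.ext fun x => ?_
    change (show Y →ₗ[ℤ] W from homGaloisModule ρY ρA σ F) (u x) =
      (show X →ₗ[ℤ] W from homGaloisModule ρX ρA σ (precompAddHom (W := W) u.toLinearMap F)) x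
    rw [homGaloisModule_apply, homGaloisModule_apply]
    change ρA σ ((show Y →ₗ[ℤ] W from F) (ρY σ⁻¹ (u x))) =
      ρA σ ((show Y →ₗ[ℤ] W from F) (u (ρX σ⁻¹ x)))
    have hu : u.toContinuousLinearMap (ρX σ⁻¹ x) = ρY σ⁻¹ (u.toContinuousLinearMap x) := by
      simpa [ContinuousRep.toContRepresentation_apply_apply] using congr($(u.isIntertwining' σ⁻¹) x)
    exact congrArg (fun y => ρA σ ((show Y →ₗ[ℤ] W from F) y)) hu.symm

/-- Unfolding: `precomp u F = F ∘ u`. [cite: MilneADT2006, I §0 (0.8)] -/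
@[simp] theorem precomp_apply_apply (u : ρX.toContRepresentation →ⁱL ρY.toContRepresentation)
    (F : DiscreteRep.HomCarrier Y W) (x : X) :
    (show X →ₗ[ℤ] W from precomp ρX ρY ρA u F) x = (show Y →ₗ[ℤ] W from F) (u x) := rfl

/-! ## §2 The invariants of `Hom(X, A)` are the equivariant homomorphisms -/

omit [Module.Finite ℤ X] in
/-- **`F ∈ Hom(X, A)^{Γ_K}` iff `F` is `Γ_K`-equivariant.** [cite: MilneADT2006, I §0 (0.8)] -/
theorem mem_invariants_iff [Module.Finite ℤ X] (F : DiscreteRep.HomCarrier X W) :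
    F ∈ (homGaloisModule ρX ρA).toTopRep.ρ.invariants ↔
      ∀ (σ : absoluteGaloisGroup K) (x : X), (show X →ₗ[ℤ] W from F) (ρX σ x) = ρA σ ((show X →ₗ[ℤ] W from F) x) := by
  constructor
  · intro hF σ x
    have h := hF σ
    change homGaloisModule ρX ρA σ F = F at h
    rw [homGaloisModule_apply] at h
    have hx := LinearMap.congr_fun h (ρX σ x)
    simp only [LinearMap.coe_comp, Function.comp_apply] at hx
    rw [← hx, ← Module.End.mul_apply, ← map_mul, inv_mul_cancel, map_one, Module.End.one_apply]
  · intro hF σ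
    change homGaloisModule ρX ρA σ F = F
    rw [homGaloisModule_apply]
    refine LinearMap.ext fun x => ?_
    simp only [LinearMap.coe_comp, Function.comp_apply]
    rw [← hF, ← Module.End.mul_apply, ← map_mul, mul_inv_cancel, map_one, Module.End.one_apply]

/-- An equivariant homomorphism as an invariant of `Hom(X, A)`. [cite: MilneADT2006, I §0 (0.8)] -/
def invariantOfEquivariant (F : X →ₗ[ℤ] W)
    (hF : ∀ (σ : absoluteGaloisGroup K) (x : X), F (ρX σ x) = ρA σ (F x)) :
    (homGaloisModule ρX ρA).toTopRep.ρ.invariants :=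
  ⟨F, (mem_invariants_iff ρX ρA F).2 hF⟩

/-- Unfolding. [cite: MilneADT2006, I §0 (0.8)] -/
@[simp] theorem coe_invariantOfEquivariant (F : X →ₗ[ℤ] W)
    (hF : ∀ (σ : absoluteGaloisGroup K) (x : X), F (ρX σ x) = ρA σ (F x)) :
    (invariantOfEquivariant ρX ρA F hF : DiscreteRep.HomCarrier X W) = F := rfl

/-! ## §3 The dual sequence is short exact -/

section Dual

variable (i : ρX.toContRepresentation →ⁱL ρY.toContRepresentation)
  (p : ρY.toContRepresentation →ⁱL ρZ.toContRepresentation)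

/-- `p^* : Hom(Z, A) ⟶ Hom(Y, A)` in `TopRep`. [cite: MilneADT2006, I §0 (0.8)] -/
abbrev dualF : (homGaloisModule ρZ ρA).toTopRep ⟶ (homGaloisModule ρY ρA).toTopRep :=
  toTopRepHom (homGaloisModule ρZ ρA) (homGaloisModule ρY ρA) (precomp ρY ρZ ρA p)

/-- `i^* : Hom(Y, A) ⟶ Hom(X, A)` in `TopRep`. [cite: MilneADT2006, I §0 (0.8)] -/
abbrev dualG : (homGaloisModule ρY ρA).toTopRep ⟶ (homGaloisModule ρX ρA).toTopRep :=
  toTopRepHom (homGaloisModule ρY ρA) (homGaloisModule ρX ρA) (precomp ρX ρY ρA i)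

/-- A divisible (more generally Baer) `ℤ`-module: every homomorphism extends along an injection.
Over `ℤ`, divisible groups are injective (tree `injective_moduleCat_int_of_divisibleBy`).
[cite: Weibel1994, §2.3 (Baer's criterion)] -/
theorem baer_of_divisibleBy (V : Type) [AddCommGroup V] [DivisibleBy V ℤ] : Module.Baer ℤ V :=
  Module.Baer.of_injective
    ((Module.injective_iff_injective_object ℤ V).2 (injective_moduleCat_int_of_divisibleBy V))

/-- **The dual of a short exact sequence of discrete modules against a Baer module is short exact**:
`0 → Hom(Z, A) → Hom(Y, A) → Hom(X, A) → 0`.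
[cite: Weibel1994, §2.3 (Baer's criterion)][cite: MilneADT2006, I §0 (0.8)] -/
theorem isSES_dual (hS : IsSES (toTopRepHom ρX ρY i) (toTopRepHom ρY ρZ p)) (hW : Module.Baer ℤ W) :
    IsSES (dualF ρY ρZ ρA p) (dualG ρX ρY ρA i) where
  comp_eq_zero := by
    apply TopRep.hom_ext
    rw [TopRep.hom_comp, TopRep.hom_zero]
    refine DFunLike.ext _ _ fun F => ?_
    change (show X →ₗ[ℤ] W from precomp ρX ρY ρA i (precomp ρY ρZ ρA p F)) = (0 : X →ₗ[ℤ] W)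
    refine LinearMap.ext fun x => ?_
    change (show Z →ₗ[ℤ] W from F) (p (i x)) = 0
    have h0 : p (i x) = 0 := hS.g_f_apply x
    rw [h0, map_zero]
  injective := by
    intro F F' h
    have h' : (show Y →ₗ[ℤ] W from precomp ρY ρZ ρA p F) = (show Y →ₗ[ℤ] W from precomp ρY ρZ ρA p F') := h
    change (show Z →ₗ[ℤ] W from F) = (show Z →ₗ[ℤ] W from F')
    refine LinearMap.ext fun z => ?_
    obtain ⟨y, rfl⟩ := hS.surjective z
    exact LinearMap.congr_fun h' y
  exact_mid := by
    intro G hG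
    have hG' : (show X →ₗ[ℤ] W from precomp ρX ρY ρA i G) = (0 : X →ₗ[ℤ] W) := hG
    have hker : LinearMap.ker p.toContinuousLinearMap.toLinearMap ≤
        LinearMap.ker (show Y →ₗ[ℤ] W from G) := by
      intro y hy
      obtain ⟨x, rfl⟩ := hS.exact_mid y hy
      exact LinearMap.congr_fun hG' x
    refine ⟨(((LinearMap.ker p.toContinuousLinearMap.toLinearMap).liftQ (show Y →ₗ[ℤ] W from G) hker) ∘ₗ
      (p.toContinuousLinearMap.toLinearMap.quotKerEquivOfSurjective hS.surjective).symm.toLinearMap :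
        Z →ₗ[ℤ] W), ?_⟩
    change (show Y →ₗ[ℤ] W from precomp ρY ρZ ρA p _) = (show Y →ₗ[ℤ] W from G)
    refine LinearMap.ext fun y => ?_
    change ((LinearMap.ker p.toContinuousLinearMap.toLinearMap).liftQ (show Y →ₗ[ℤ] W from G) hker)
      ((p.toContinuousLinearMap.toLinearMap.quotKerEquivOfSurjective hS.surjective).symm
        (p.toContinuousLinearMap.toLinearMap y)) = (show Y →ₗ[ℤ] W from G) y
    rw [LinearMap.quotKerEquivOfSurjective_symm_apply, Submodule.liftQ_apply]
  surjective := by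
    intro h
    obtain ⟨F, hF⟩ := hW.extension_property i.toContinuousLinearMap.toLinearMap hS.injective
      (show X →ₗ[ℤ] W from h)
    exact ⟨(F : DiscreteRep.HomCarrier Y W), hF⟩

/-- **The connecting map `δ₀ : Hom_{Γ_K}(N₁, A) → H¹(K, Hom(N, A))`** of the dual sequence (native
`IsSES.δ₀`). [cite: SerreGaloisCohomology1997, I §2.2][cite: MilneADT2006, I Lemma 4.13 (proof)] -/
def dualδ₀ (hS : IsSES (toTopRepHom ρX ρY i) (toTopRepHom ρY ρZ p)) (hW : Module.Baer ℤ W) :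
    (homGaloisModule ρX ρA).toTopRep.ρ.invariants →+ galoisCohomology (homGaloisModule ρZ ρA) 1 :=
  (isSES_dual ρX ρY ρZ ρA i p hS hW).δ₀.toAddMonoidHom

/-- Unfolding: `dualδ₀` is the native `IsSES.δ₀` of the dual sequence. [cite: SerreGaloisCohomology1997, I §2.2] -/
theorem dualδ₀_apply (hS : IsSES (toTopRepHom ρX ρY i) (toTopRepHom ρY ρZ p)) (hW : Module.Baer ℤ W)
    (h : (homGaloisModule ρX ρA).toTopRep.ρ.invariants) :
    dualδ₀ ρX ρY ρZ ρA i p hS hW h = (isSES_dual ρX ρY ρZ ρA i p hS hW).δ₀ h := rfl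

/-- `δ₀ (q ∘ i) = 0` for an EQUIVARIANT `q : Y → A` (exactness at `Hom_{Γ}(N₁, A)`).
[cite: SerreGaloisCohomology1997, I §2.2] -/
theorem dualδ₀_precomp_eq_zero (hS : IsSES (toTopRepHom ρX ρY i) (toTopRepHom ρY ρZ p))
    (hW : Module.Baer ℤ W) (q : (homGaloisModule ρY ρA).toTopRep.ρ.invariants)
    (h : (homGaloisModule ρX ρA).toTopRep.ρ.invariants)
    (hq : (h : DiscreteRep.HomCarrier X W) = precomp ρX ρY ρA i q) :
    dualδ₀ ρX ρY ρZ ρA i p hS hW h = 0 := by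
  rw [dualδ₀_apply]
  exact ((isSES_dual ρX ρY ρZ ρA i p hS hW).δ₀_eq_zero_iff h).2 ⟨q, q.2, hq.symm⟩

/-- Conversely `δ₀ h = 0` iff `h = q ∘ i` for an equivariant `q : Y → A`.
[cite: SerreGaloisCohomology1997, I §2.2] -/
theorem dualδ₀_eq_zero_iff (hS : IsSES (toTopRepHom ρX ρY i) (toTopRepHom ρY ρZ p))
    (hW : Module.Baer ℤ W) (h : (homGaloisModule ρX ρA).toTopRep.ρ.invariants) :
    dualδ₀ ρX ρY ρZ ρA i p hS hW h = 0 ↔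
      ∃ q : (homGaloisModule ρY ρA).toTopRep.ρ.invariants, (h : DiscreteRep.HomCarrier X W) = precomp ρX ρY ρA i q := by
  refine ((isSES_dual ρX ρY ρZ ρA i p hS hW).δ₀_eq_zero_iff h).trans ⟨?_, ?_⟩
  · rintro ⟨w, hw, hwh⟩
    exact ⟨⟨w, hw⟩, hwh.symm⟩
  · rintro ⟨q, hq⟩
    exact ⟨q, q.2, hq.symm⟩

/-- Two equivariant homomorphisms have the same `δ₀` iff they differ by the restriction of an
equivariant `q : Y → A`. [cite: SerreGaloisCohomology1997, I §2.2] -/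
theorem dualδ₀_eq_dualδ₀_iff (hS : IsSES (toTopRepHom ρX ρY i) (toTopRepHom ρY ρZ p))
    (hW : Module.Baer ℤ W) (h h' : (homGaloisModule ρX ρA).toTopRep.ρ.invariants) :
    dualδ₀ ρX ρY ρZ ρA i p hS hW h = dualδ₀ ρX ρY ρZ ρA i p hS hW h' ↔
      ∃ q : (homGaloisModule ρY ρA).toTopRep.ρ.invariants,
        (h : DiscreteRep.HomCarrier X W) = (h' : DiscreteRep.HomCarrier X W) + precomp ρX ρY ρA i q := by
  rw [← sub_eq_zero, ← map_sub, dualδ₀_eq_zero_iff]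
  constructor
  · rintro ⟨q, hq⟩
    exact ⟨q, by rw [← hq]; exact (add_sub_cancel _ _).symm⟩
  · rintro ⟨q, hq⟩
    refine ⟨q, ?_⟩
    change (h : DiscreteRep.HomCarrier X W) - (h' : DiscreteRep.HomCarrier X W) = _
    rw [hq, add_sub_cancel_left]

/-- **Every class of `H¹(K, Hom(N, A))` is `δ₀` of an equivariant homomorphism `N₁ → A`, as soon as
`H¹(K, Hom(P, A)) = 0`** (exactness at `H¹(K, Hom(N, A))`). [cite: SerreGaloisCohomology1997, I §2.2][cite: MilneADT2006, I Lemma 4.13 (proof)] -/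
theorem dualδ₀_surjective (hS : IsSES (toTopRepHom ρX ρY i) (toTopRepHom ρY ρZ p)) (hW : Module.Baer ℤ W)
    (hY : ∀ ζ : galoisCohomology (homGaloisModule ρY ρA) 1, ζ = 0) :
    Function.Surjective (dualδ₀ ρX ρY ρZ ρA i p hS hW) := fun ξ => by
  obtain ⟨v, hv⟩ := (isSES_dual ρX ρY ρZ ρA i p hS hW).exists_δ₀_eq_of_map_one_eq_zero ξ (hY _)
  exact ⟨v, hv⟩

end Dual

end HomDual

end Literature.NumberTheory.GaloisRepresentations

end
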